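import Mathlib.RingTheory.MvPolynomial.Homogeneous
import Mathlib.Data.Finsupp.Option
import Literature.Combinatorics.StablePolynomials.Limits
import HarnessLib

/-!
# Homogenization of a stable polynomial with nonnegative coefficients (Borcea–Brändén–Liggett, Thm. 4.5)

Borcea–Brändén–Liggett, *Negative dependence and the geometry of polynomials*, J. Amer. Math. Soc. 22
(2009) 521–567 (arXiv:0707.2340), §4.1. For `f(z) = Σ_α a(α) z^α ∈ ℂ[z_1, …, z_n]` of degree `d` the
**homogenization** is `f_H(z_1, …, z_{n+1}) = z_{n+1}^d f(z_1/z_{n+1}, …, z_n/z_{n+1})` (loc. cit., before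
Prop. 4.3), and

> **Theorem 4.5.** Suppose that all the coefficients of `f ∈ ℝ[z_1, …, z_n]` are non-negative. The following
> are equivalent: (1) `f_H` is stable; (2) `f` is stable; (3) `f_H` is hyperbolic with respect to some vector
> `e` with `e_i ≥ 0`; (4) `f_H` is hyperbolic with respect to any vector `e` with `e_i > 0`.

This file vendors the definition and PROVES the equivalence (1) ⇔ (2) (`isRealStable_homogenize_iff`; the
direction (1) ⇒ (2), `isRealStable_of_isRealStable_homogenize`, holds for every real `f`). The printed proof
of (2) ⇒ (1) runs (2) ⇒ (3) by Prop. 4.3 ("`f` is real stable iff `f_H` is hyperbolic with respect to all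
`(e_1, …, e_n, 0)`, `e_i > 0`"), (3) ⇒ (4) by Gårding's theorem (Prop. 4.4 (b), (d): the hyperbolicity
cone `C_e(f_H)` is the component of `{f_H ≠ 0}` containing `e`, it contains the open orthant because the
coefficients are non-negative, and `f_H` is hyperbolic with respect to every vector of `C_e(f_H)`), and
(4) ⇒ (1) by the line criterion (Prop. 2.3 (1) of loc. cit. = the tree's `isRealStable_of_line`). The tree
has no theory of Gårding hyperbolic polynomials; the one instance of Prop. 4.4 (d) that is needed —
hyperbolicity of `f_H` in direction `e = (𝟙, 0)` (this is Prop. 4.3, i.e. stability of `f` and of its top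
form) transfers to every direction `B` of the open orthant — is proved inline by Gårding's root-continuity
argument [Garding1959, §2]: the polynomials `t ↦ f_H(A + ie + tB)` (`A` real) have no real zeros; at `A = 0`
all zeros have negative imaginary part (`f_H(ie + tB) = t^d f_H(B + (i/t)e)`, and the zeros of
`λ ↦ f_H(B + λe)` are real by Prop. 4.3 and negative because `f_H > 0` on the open orthant); moving `A`
along a segment no zero can cross the real axis (zeros stay bounded, a first parameter with a zero in the
closed upper half-plane is refuted by Hurwitz's theorem, here the tree's
`eq_zero_or_isUpperHalfPlaneStable_of_mem_closure`); finally `α → 0⁺` in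
`f_H(A + iαe + tB) = α^d f_H(A/α + ie + (t/α)B)` (Hurwitz again) and conjugation symmetry show that
`t ↦ f_H(A + tB)` has only real zeros.

## Main definitions and results (namespace `Literature.Combinatorics.StablePolynomials`)

* `homogenize N f` — `Σ_α a(α) z^α z₀^{N - |α|} ∈ R[z_{Option σ}]` (`z₀ = X none`; for `N = deg f` this is
  `f_H`, for `N ≥ deg f` it is `z₀^{N - deg f} f_H`), with `coeff_homogenize`, `isHomogeneous_homogenize`,
  `eval_homogenize` / `eval_map_homogenize` (the expansion), `eval_map_homogenize_of_ne_zero` (the identity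
  `f_H(z, z₀) = z₀^N f(z/z₀)`), `eval_map_homogenize_of_eq_zero` (`f_H(z, 0) = f_N(z)`, the top form),
  `eval_homogenize_one` (`f_H(z, 1) = f(z)`), `homogenize_add_eq_X_pow_mul`; §5 linearity (`homogenize_add`,
  `homogenize_smul`, `homogenize_sum`, `homogenize_monomial`, `homogenize_C`, `homogenize_X`).
* `IsUpperHalfPlaneStable.homogeneousComponent_totalDegree` — the top form of a stable polynomial is stable
  (Choe–Oxley–Sokal–Wagner, Prop. 2.2, by Hurwitz: `f_d(z) = lim_{s → 0⁺} s^d f(z/s)`).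
* `isRealStable_of_isRealStable_homogenize` — **Thm. 4.5 (1) ⇒ (2)** (any real `f`, `N ≥ deg f`).
* `IsRealStable.homogenize` — **Thm. 4.5 (2) ⇒ (1)**: `f` real stable with nonnegative coefficients and
  `N ≥ deg f` ⟹ `homogenize N f` real stable; `isRealStable_homogenize_iff` — **Thm. 4.5 (1) ⇔ (2)**.

## References

* J. Borcea, P. Brändén, T. M. Liggett, *Negative dependence and the geometry of polynomials*, J. Amer.
  Math. Soc. 22 (2009), 521–567; arXiv:0707.2340, §4.1 (Prop. 4.3, Prop. 4.4, Thm. 4.5).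
  [BorceaBrandenLiggett2007]
* L. Gårding, *An inequality for hyperbolic polynomials*, J. Math. Mech. 8 (1959), 957–965, §2.
  [Garding1959]
* Y.-B. Choe, J. G. Oxley, A. D. Sokal, D. G. Wagner, *Homogeneous multivariate polynomials with the
  half-plane property*, Adv. Appl. Math. 32 (2004), 88–187, §2.2 Prop. 2.2. [ChoeOxleySokalWagner2004]
* D. G. Wagner, *Multivariate stable polynomials: theory and applications*, Bull. AMS 48 (2011), §2
  (Hurwitz's theorem). [Wagner2011]
-/

noncomputable section

open MvPolynomial Finset Filter Topology ComplexConjugate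

namespace Literature.Combinatorics.StablePolynomials

/-! ## §1 The homogenization `f_H` in the distinguished variable `z₀ = X none` -/

section Defs

variable {σ : Type*} {R : Type*} [CommSemiring R]

/-- **Homogenization in degree `N`** of `f = Σ_α a(α) z^α ∈ R[z_σ]`: the polynomial
`Σ_α a(α) z^α z₀^{N - |α|}` in the variables `Option σ`, the homogenising variable being `z₀ = X none`
(Borcea–Brändén–Liggett: "the homogenization of a polynomial `f(z_1, …, z_n) = Σ_{α ∈ ℕ^n} a(α) z^α` of
degree `d` is given by `f_H(z_1, …, z_{n+1}) = z_{n+1}^d f(z_1/z_{n+1}, …, z_n/z_{n+1})`"; that is the case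
`N = d`, and `homogenize N f = z₀^{N-d} f_H` for `N ≥ d`, cf. `homogenize_add_eq_X_pow_mul`,
`eval_map_homogenize_of_ne_zero`). [cite: BorceaBrandenLiggett2007, §4.1 (definition of `f_H` before
Prop. 4.3)] -/
def homogenize (N : ℕ) (f : MvPolynomial σ R) : MvPolynomial (Option σ) R :=
  ∑ m ∈ f.support, monomial (m.optionElim (N - m.degree)) (coeff m f)

/-- `homogenize` unfolded. [cite: BorceaBrandenLiggett2007, §4.1 (definition of `f_H`)] -/
theorem homogenize_def (N : ℕ) (f : MvPolynomial σ R) :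
    homogenize N f = ∑ m ∈ f.support, monomial (m.optionElim (N - m.degree)) (coeff m f) := rfl

/-- The exponent `(α, N - |α|)` determines `α`. [folklore] -/
private theorem optionElim_sub_inj {N : ℕ} {m m' : σ →₀ ℕ}
    (h : m.optionElim (N - m.degree) = m'.optionElim (N - m'.degree)) : m = m' := by
  have := congrArg Finsupp.some h
  simpa only [Finsupp.some_optionElim] using this

/-- The degree of the exponent `(α, k)` is `k + |α|`. [folklore] -/
private theorem degree_optionElim (k : ℕ) (m : σ →₀ ℕ) : (m.optionElim k).degree = k + m.degree := by
  classical
  have h := Finsupp.sum_option_index (m.optionElim k) (fun _ e => e) (fun _ => rfl) fun _ _ _ => rfl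
  simp only [Finsupp.optionElim_apply_none, Finsupp.some_optionElim] at h
  exact h

/-- `|α| ≤ deg f` for `α` in the support. [folklore] -/
private theorem degree_le_totalDegree {f : MvPolynomial σ R} {m : σ →₀ ℕ} (hm : m ∈ f.support) :
    m.degree ≤ f.totalDegree :=
  le_totalDegree hm

/-- **The coefficients of `f_H`**: the coefficient of `z^α z₀^k` is `a(α)` if `k = N - |α|` and `0`
otherwise. [cite: BorceaBrandenLiggett2007, §4.1 (definition of `f_H`)] -/
theorem coeff_homogenize (N : ℕ) (f : MvPolynomial σ R) (n : Option σ →₀ ℕ) :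
    coeff n (homogenize N f) = if n none = N - n.some.degree then coeff n.some f else 0 := by
  classical
  rw [homogenize, coeff_sum]
  simp only [coeff_monomial]
  split_ifs with h
  · have hn : n.some.optionElim (N - n.some.degree) = n := by
      rw [← h]
      exact Finsupp.optionElim_some n
    rw [Finset.sum_eq_single n.some]
    · rw [if_pos hn]
    · intro m _ hm
      rw [if_neg]
      intro hmn
      apply hm
      have := congrArg Finsupp.some hmn
      simpa only [Finsupp.some_optionElim] using this
    · intro hm
      rw [if_pos hn, notMem_support_iff.1 hm]
  · refine Finset.sum_eq_zero fun m _ => ?_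
    rw [if_neg]
    intro hmn
    apply h
    rw [← hmn, Finsupp.optionElim_apply_none, Finsupp.some_optionElim]

/-- The coefficient of `z^α z₀^{N-|α|}` in `f_H` is `a(α)`. [cite: BorceaBrandenLiggett2007, §4.1] -/
theorem coeff_homogenize_optionElim (N : ℕ) (f : MvPolynomial σ R) (m : σ →₀ ℕ) :
    coeff (m.optionElim (N - m.degree)) (homogenize N f) = coeff m f := by
  rw [coeff_homogenize, Finsupp.optionElim_apply_none, Finsupp.some_optionElim, if_pos rfl]

/-- `f_H = 0` iff `f = 0`. [cite: BorceaBrandenLiggett2007, §4.1] -/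
theorem homogenize_eq_zero_iff (N : ℕ) (f : MvPolynomial σ R) : homogenize N f = 0 ↔ f = 0 := by
  constructor
  · intro h
    ext m
    rw [← coeff_homogenize_optionElim N f m, h, coeff_zero, coeff_zero]
  · rintro rfl
    rw [homogenize, support_zero, Finset.sum_empty]

/-- The support of `f_H` is `{(α, N - |α|) : α ∈ supp f}`. [cite: BorceaBrandenLiggett2007, §4.1] -/
theorem support_homogenize [DecidableEq σ] (N : ℕ) (f : MvPolynomial σ R) :
    (homogenize N f).support = f.support.image fun m => m.optionElim (N - m.degree) := by
  ext n
  rw [mem_support_iff, coeff_homogenize, Finset.mem_image]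
  constructor
  · intro h
    by_cases hn : n none = N - n.some.degree
    · rw [if_pos hn] at h
      refine ⟨n.some, mem_support_iff.2 h, ?_⟩
      rw [← hn]
      exact Finsupp.optionElim_some n
    · rw [if_neg hn] at h
      exact absurd rfl h
  · rintro ⟨m, hm, rfl⟩
    rw [Finsupp.optionElim_apply_none, Finsupp.some_optionElim, if_pos rfl]
    exact mem_support_iff.1 hm

/-- **`f_H` is homogeneous of degree `N`** (for `N ≥ deg f`). [cite: BorceaBrandenLiggett2007, §4.1
(definition of `f_H`)] -/
theorem isHomogeneous_homogenize {N : ℕ} {f : MvPolynomial σ R} (hN : f.totalDegree ≤ N) :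
    (homogenize N f).IsHomogeneous N := by
  rw [homogenize]
  refine IsHomogeneous.sum _ _ _ fun m hm => isHomogeneous_monomial _ ?_
  rw [degree_optionElim]
  have := degree_le_totalDegree hm
  omega

/-- Homogenization commutes with an injective change of coefficients (e.g. `ℝ → ℂ`).
[cite: BorceaBrandenLiggett2007, §4.1] -/
theorem map_homogenize {S : Type*} [CommSemiring S] {φ : R →+* S} (hφ : Function.Injective φ) (N : ℕ)
    (f : MvPolynomial σ R) : map φ (homogenize N f) = homogenize N (map φ f) := by
  rw [homogenize, homogenize, map_sum, support_map_of_injective f hφ]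
  refine Finset.sum_congr rfl fun m _ => ?_
  rw [map_monomial, coeff_map]

/-- The total degree is unchanged by an injective change of coefficients. [folklore] -/
private theorem totalDegree_map_of_injective {S : Type*} [CommSemiring S] {φ : R →+* S}
    (hφ : Function.Injective φ) (f : MvPolynomial σ R) : (map φ f).totalDegree = f.totalDegree := by
  rw [totalDegree, totalDegree, support_map_of_injective f hφ]

/-- `homogeneousComponent` commutes with a change of coefficients. [folklore] -/
private theorem map_homogeneousComponent {S : Type*} [CommSemiring S] (φ : R →+* S) (N : ℕ)
    (f : MvPolynomial σ R) : map φ (homogeneousComponent N f) = homogeneousComponent N (map φ f) := by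
  ext m
  rw [coeff_map, coeff_homogeneousComponent, coeff_homogeneousComponent, coeff_map]
  split_ifs
  · rfl
  · rw [map_zero]

/-- **Raising `N` multiplies by the homogenising variable**: `homogenize (N + k) f = z₀^k · homogenize N f`
for `N ≥ deg f`. [cite: BorceaBrandenLiggett2007, §4.1 (definition of `f_H`)] -/
theorem homogenize_add_eq_X_pow_mul {N : ℕ} {f : MvPolynomial σ R} (hN : f.totalDegree ≤ N) (k : ℕ) :
    homogenize (N + k) f = X none ^ k * homogenize N f := by
  rw [homogenize, homogenize, Finset.mul_sum]
  refine Finset.sum_congr rfl fun m hm => ?_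
  have hexp : (Finsupp.single none k : Option σ →₀ ℕ) + m.optionElim (N - m.degree) =
      m.optionElim (N + k - m.degree) := by
    refine Finsupp.ext fun o => ?_
    cases o with
    | none =>
      simp only [Finsupp.add_apply, Finsupp.single_eq_same, Finsupp.optionElim_apply_none]
      have := degree_le_totalDegree hm
      omega
    | some i =>
      simp only [Finsupp.add_apply, Finsupp.optionElim_apply_some, Finsupp.single_apply, reduceCtorEq,
        if_false, zero_add]
  rw [X_pow_eq_monomial, monomial_mul, one_mul, hexp]

/-- **Expansion of `f_H` at a point**: `f_H(w) = Σ_α a(α) w₀^{N-|α|} Π_i w_i^{α_i}`.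
[cite: BorceaBrandenLiggett2007, §4.1 (definition of `f_H`)] -/
theorem eval_homogenize (N : ℕ) (f : MvPolynomial σ R) (w : Option σ → R) :
    eval w (homogenize N f) =
      ∑ m ∈ f.support, coeff m f * (w none ^ (N - m.degree) * ∏ i ∈ m.support, w (some i) ^ m i) := by
  rw [homogenize, map_sum]
  refine Finset.sum_congr rfl fun m _ => ?_
  rw [eval_monomial, Finsupp.prod_option_index _ _ (fun _ => pow_zero _) fun _ _ _ => pow_add _ _ _]
  simp only [Finsupp.optionElim_apply_none, Finsupp.some_optionElim]
  rfl

/-- Expansion of `f_H` after a change of coefficients `φ`: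
`(φ f)_H(w) = Σ_α φ(a(α)) w₀^{N-|α|} Π_i w_i^{α_i}`. [cite: BorceaBrandenLiggett2007, §4.1] -/
theorem eval_map_homogenize {S : Type*} [CommSemiring S] (φ : R →+* S) (N : ℕ) (f : MvPolynomial σ R)
    (w : Option σ → S) :
    eval w (map φ (homogenize N f)) =
      ∑ m ∈ f.support, φ (coeff m f) * (w none ^ (N - m.degree) * ∏ i ∈ m.support, w (some i) ^ m i) := by
  rw [homogenize, map_sum, map_sum]
  refine Finset.sum_congr rfl fun m _ => ?_
  rw [map_monomial, eval_monomial,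
    Finsupp.prod_option_index _ _ (fun _ => pow_zero _) fun _ _ _ => pow_add _ _ _]
  simp only [Finsupp.optionElim_apply_none, Finsupp.some_optionElim]
  rfl

/-- **`f_H(z, 1) = f(z)`** (for `N ≥ deg f`; Borcea–Brändén–Liggett use it as "setting variables equal to
real numbers", (1) ⇒ (2) of Thm. 4.5). [cite: BorceaBrandenLiggett2007, §4.1 proof of Thm. 4.5] -/
theorem eval_homogenize_one (N : ℕ) (f : MvPolynomial σ R) (z : σ → R) :
    eval (fun o => o.elim 1 z) (homogenize N f) = eval z f := by
  rw [eval_homogenize, eval_eq]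
  refine Finset.sum_congr rfl fun m _ => ?_
  simp only [Option.elim_none, Option.elim_some, one_pow, one_mul]

end Defs

/-! ### The identities `f_H(z, z₀) = z₀^N f(z/z₀)` and `f_H(z, 0) = f_N(z)` over a field -/

section Field

variable {σ : Type*} {R : Type*} [CommSemiring R] {K : Type*} [Field K]

/-- **`f_H(z, z₀) = z₀^N f(z/z₀)` for `z₀ ≠ 0`** (the defining identity of the homogenization, `N ≥ deg f`).
[cite: BorceaBrandenLiggett2007, §4.1 (definition of `f_H`)] -/
theorem eval_map_homogenize_of_ne_zero (φ : R →+* K) {N : ℕ} {f : MvPolynomial σ R}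
    (hN : f.totalDegree ≤ N) {w : Option σ → K} (hw : w none ≠ 0) :
    eval w (map φ (homogenize N f)) = w none ^ N * eval (fun i => w (some i) / w none) (map φ f) := by
  rw [eval_map_homogenize, eval_map, eval₂_eq, Finset.mul_sum]
  refine Finset.sum_congr rfl fun m hm => ?_
  have hdeg : m.degree ≤ N := (degree_le_totalDegree hm).trans hN
  have hprod : ∏ i ∈ m.support, (w (some i) / w none) ^ m i =
      (∏ i ∈ m.support, w (some i) ^ m i) / w none ^ m.degree := by
    simp only [div_pow, Finset.prod_div_distrib, Finset.prod_pow_eq_pow_sum]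
    rfl
  rw [hprod, pow_sub₀ _ hw hdeg]
  field_simp

/-- **`f_H(z, 0) = f_N(z)`**, the top form, for `N ≥ deg f` (when `N = deg f` this is the top homogeneous
component of `f`; when `N > deg f` it is `0`). [cite: BorceaBrandenLiggett2007, §4.1 (definition of
`f_H`)] -/
theorem eval_map_homogenize_of_eq_zero (φ : R →+* K) {N : ℕ} {f : MvPolynomial σ R}
    (hN : f.totalDegree ≤ N) {w : Option σ → K} (hw : w none = 0) :
    eval w (map φ (homogenize N f)) = eval (fun i => w (some i)) (map φ (homogeneousComponent N f)) := by
  classical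
  rw [eval_map_homogenize, map_homogeneousComponent, eval_eq]
  -- the support of the top component inside the support of `f`
  have hsub : (homogeneousComponent N (map φ f)).support ⊆ f.support := fun m hm => by
    have h := mem_support_iff.1 hm
    rw [coeff_homogeneousComponent, coeff_map] at h
    by_contra hmf
    rw [notMem_support_iff.1 hmf, map_zero, ite_self] at h
    exact h rfl
  rw [← Finset.sum_subset hsub]
  · refine Finset.sum_congr rfl fun m hm => ?_
    have h := mem_support_iff.1 hm
    rw [coeff_homogeneousComponent] at h
    have hmN : m.degree = N := by
      by_contra hne
      rw [if_neg hne] at h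
      exact h rfl
    rw [coeff_homogeneousComponent, if_pos hmN, coeff_map, hw, hmN, Nat.sub_self, pow_zero, one_mul]
  · intro m hm hm'
    -- either `φ (a m) = 0` or `|m| < N`, where `0^{N-|m|} = 0`
    have hmf : coeff m (homogeneousComponent N (map φ f)) = 0 := notMem_support_iff.1 hm'
    rw [coeff_homogeneousComponent, coeff_map] at hmf
    by_cases hdeg : m.degree = N
    · rw [if_pos hdeg] at hmf
      rw [hmf, zero_mul]
    · have hlt : m.degree < N := lt_of_le_of_ne ((degree_le_totalDegree hm).trans hN) hdeg
      rw [hw, zero_pow (Nat.sub_ne_zero_of_lt hlt), zero_mul, mul_zero]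

end Field

/-! ## §2 Coefficientwise facts: nonnegativity, positivity on the orthant, the top form -/

section Coeff

variable {σ : Type*}

/-- `f_H` has nonnegative coefficients when `f` has. [cite: BorceaBrandenLiggett2007, §4.1 (Thm. 4.5,
"since `f` has all non-negative coefficients")] -/
theorem coeff_homogenize_nonneg {f : MvPolynomial σ ℝ} (hnn : ∀ m, 0 ≤ coeff m f) (N : ℕ)
    (n : Option σ →₀ ℕ) : 0 ≤ coeff n (homogenize N f) := by
  rw [coeff_homogenize]
  split_ifs
  · exact hnn _
  · exact le_rfl

/-- **A nonzero real polynomial with nonnegative coefficients is positive on the open orthant** (the fact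
behind "`C_e(f_H)` contains the cone `ℝ_+^{n+1}`" in the proof of Thm. 4.5). Local copy of
`Literature.Combinatorics.LorentzianPolynomials.eval_pos_of_coeff_nonneg` (`StableQuadratic.lean`, which imports
this directory and so cannot be imported here). [cite: BorceaBrandenLiggett2007, §4.1 proof of Thm. 4.5] -/
private theorem eval_pos_of_coeff_nonneg {f : MvPolynomial σ ℝ} (hnn : ∀ m, 0 ≤ coeff m f) (hf : f ≠ 0)
    {x : σ → ℝ} (hx : ∀ i, 0 < x i) : 0 < eval x f := by
  rw [eval_eq]
  have hne : f.support.Nonempty := Finset.nonempty_of_ne_empty fun h => hf (support_eq_empty.1 h)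
  obtain ⟨m, hm⟩ := hne
  refine Finset.sum_pos' (fun m' _ => mul_nonneg (hnn m') (Finset.prod_nonneg fun i _ => (pow_pos (hx i) _).le))
    ⟨m, hm, mul_pos ((hnn m).lt_of_ne' (mem_support_iff.1 hm)) (Finset.prod_pos fun i _ => pow_pos (hx i) _)⟩

/-- Evaluation of the complexification at a real vector. [folklore] -/
private theorem eval_map_real (g : MvPolynomial σ ℝ) (y : σ → ℝ) :
    eval (fun k => (y k : ℂ)) (map (algebraMap ℝ ℂ) g) = ((eval y g : ℝ) : ℂ) := by
  induction g using MvPolynomial.induction_on with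
  | C a => simp
  | add p q hp hq => simp only [map_add, hp, hq, Complex.ofReal_add]
  | mul_X p k hp => simp only [map_mul, hp, map_X, eval_X, Complex.ofReal_mul]

/-- A real stable polynomial is not zero. [folklore] -/
private theorem IsRealStable.ne_zero' {f : MvPolynomial σ ℝ} (hf : IsRealStable f) : f ≠ 0 := by
  rintro rfl
  exact hf (fun _ => Complex.I) (fun _ => by simp) (by rw [map_zero, map_zero])

/-- `F(c • v) = c^n F(v)` for a form `F` of degree `n`. [folklore] -/
private theorem eval_smul_eq_pow_mul {τ : Type*} {F : MvPolynomial τ ℂ} {n : ℕ} (hF : F.IsHomogeneous n)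
    (c : ℂ) (v : τ → ℂ) : eval (c • v) F = c ^ n * eval v F := by
  rw [eval_eq, eval_eq, Finset.mul_sum]
  refine Finset.sum_congr rfl fun m hm => ?_
  simp only [Pi.smul_apply, smul_eq_mul, mul_pow, Finset.prod_mul_distrib, Finset.prod_pow_eq_pow_sum,
    ← hF.degree_eq_sum_deg_support hm]
  ring

/-- The complexified homogenization is a form of degree `N`. [cite: BorceaBrandenLiggett2007, §4.1] -/
private theorem isHomogeneous_map_homogenize {f : MvPolynomial σ ℝ} {N : ℕ} (hN : f.totalDegree ≤ N) :
    (map (algebraMap ℝ ℂ) (homogenize N f)).IsHomogeneous N := by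
  rw [map_homogenize (RingHom.injective _)]
  exact isHomogeneous_homogenize (by rwa [totalDegree_map_of_injective (RingHom.injective _)])

end Coeff

section TopForm

variable {σ : Type*} [Finite σ]

/-- **The top form of a stable polynomial is stable** (Choe–Oxley–Sokal–Wagner, Prop. 2.2: "If `P` has the
[shifted] half-plane property, then `P♯` has the half-plane property", `P♯` = the terms of top degree,
"`P♯(x) = lim_{ζ→∞} ζ^{-r} P(ζx)` … using Hurwitz's theorem"; here for the upper half-plane). Proof: the
polynomials `Σ_α a(α) s^{d-|α|} z^α = s^d p(z/s)` are stable for real `s > 0` and tend to `p♯` as `s → 0⁺`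
(tree: `eq_zero_or_isUpperHalfPlaneStable_of_mem_closure`), and `p♯ ≠ 0`.
[cite: ChoeOxleySokalWagner2004, §2.2 Prop. 2.2] -/
theorem IsUpperHalfPlaneStable.homogeneousComponent_totalDegree {p : MvPolynomial σ ℂ}
    (hp : IsUpperHalfPlaneStable p) (hp0 : p ≠ 0) :
    IsUpperHalfPlaneStable (homogeneousComponent p.totalDegree p) := by
  classical
  set d := p.totalDegree with hd
  -- the family `s ↦ Σ_α a(α) s^{d-|α|} z^α`
  let P : ℝ → MvPolynomial σ ℂ := fun s => ∑ m ∈ p.support, monomial m (coeff m p * (s : ℂ) ^ (d - m.degree))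
  have hPeval : ∀ s z, eval z (P s) =
      ∑ m ∈ p.support, coeff m p * (s : ℂ) ^ (d - m.degree) * ∏ i ∈ m.support, z i ^ m i := by
    intro s z
    simp only [P, map_sum, eval_monomial]
    rfl
  have hcont : Continuous fun sz : ℝ × (σ → ℂ) => eval sz.2 (P sz.1) := by
    simp only [hPeval]
    refine continuous_finsetSum _ fun m _ => ?_
    refine (continuous_const.mul ((Complex.continuous_ofReal.comp continuous_fst).pow _)).mul ?_
    exact continuous_finsetProd _ fun i _ => ((continuous_apply i).comp continuous_snd).pow _
  -- `P s (z) = s^d p(z/s)` for `s ≠ 0`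
  have hscale : ∀ s : ℝ, s ≠ 0 → ∀ z, eval z (P s) = (s : ℂ) ^ d * eval (fun i => z i / s) p := by
    intro s hs z
    have hs' : (s : ℂ) ≠ 0 := Complex.ofReal_ne_zero.2 hs
    rw [hPeval, eval_eq, Finset.mul_sum]
    refine Finset.sum_congr rfl fun m hm => ?_
    have hdeg : m.degree ≤ d := le_totalDegree hm
    have hprod : ∏ i ∈ m.support, (z i / s) ^ m i = (∏ i ∈ m.support, z i ^ m i) / (s : ℂ) ^ m.degree := by
      simp only [div_pow, Finset.prod_div_distrib, Finset.prod_pow_eq_pow_sum]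
      rfl
    rw [hprod, pow_sub₀ _ hs' hdeg]
    field_simp
  have hstab : ∀ s ∈ Set.Ioi (0 : ℝ), IsUpperHalfPlaneStable (P s) := by
    intro s hs z hz
    rw [hscale s (ne_of_gt hs)]
    refine mul_ne_zero (pow_ne_zero _ (Complex.ofReal_ne_zero.2 (ne_of_gt hs))) (hp _ fun i => ?_)
    rw [Complex.div_ofReal_im]
    exact div_pos (hz i) hs
  have hcl : (0 : ℝ) ∈ closure (Set.Ioi (0 : ℝ)) := by
    rw [closure_Ioi]
    exact Set.self_mem_Ici
  -- at `s = 0` the family is the top form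
  have hP0 : P 0 = homogeneousComponent d p := by
    ext m
    rw [coeff_homogeneousComponent]
    simp only [P, coeff_sum, coeff_monomial, Complex.ofReal_zero]
    rw [Finset.sum_ite_eq' p.support m]
    by_cases hm : m ∈ p.support
    · rw [if_pos hm]
      have hdeg : m.degree ≤ d := le_totalDegree hm
      by_cases hmd : m.degree = d
      · rw [if_pos hmd, hmd, Nat.sub_self, pow_zero, mul_one]
      · rw [if_neg hmd, zero_pow (by omega), mul_zero]
    · rw [if_neg hm, notMem_support_iff.1 hm, ite_self]
  rcases eq_zero_or_isUpperHalfPlaneStable_of_mem_closure hcont hstab hcl with h0 | h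
  · exfalso
    rw [hP0] at h0
    have hne : p.support.Nonempty := Finset.nonempty_of_ne_empty fun h => hp0 (support_eq_empty.1 h)
    obtain ⟨m, hm, hmd⟩ := Finset.exists_mem_eq_sup p.support hne fun s => s.sum fun _ e => e
    have hmd' : m.degree = d := by rw [hd, totalDegree, hmd]; rfl
    have : coeff m (homogeneousComponent d p) = coeff m p := by
      rw [coeff_homogeneousComponent, if_pos hmd']
    rw [h0, coeff_zero] at this
    exact mem_support_iff.1 hm this.symm
  · rwa [hP0] at h

/-- The top form of a real stable polynomial is real stable. [cite: ChoeOxleySokalWagner2004, §2.2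
Prop. 2.2] [cite: BorceaBrandenLiggett2007, §4.1 Prop. 4.3] -/
theorem IsRealStable.homogeneousComponent_totalDegree {f : MvPolynomial σ ℝ} (hf : IsRealStable f) :
    IsRealStable (homogeneousComponent f.totalDegree f) := by
  have hf0 : map (algebraMap ℝ ℂ) f ≠ 0 := fun h =>
    hf.ne_zero' (map_injective _ (RingHom.injective _) (by rw [h, map_zero]))
  have h := IsUpperHalfPlaneStable.homogeneousComponent_totalDegree hf hf0
  rw [totalDegree_map_of_injective (RingHom.injective _), ← map_homogeneousComponent] at h
  exact h

end TopForm

/-! ## §3 Gårding's argument for `f_H`: from the direction `e = (𝟙, 0)` to the open orthant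

Throughout, `F = (homogenize d f)^ℂ` with `d = deg f`, `e = (𝟙, 0)` (`e_{some i} = 1`, `e_none = 0`), points are
written `A + ie + tB` with `A` real and `B` in the open orthant. -/

section Garding

variable {σ : Type*} [Fintype σ]

/-- A form that does not vanish on the ball `dist(v, b) < δ` does not vanish at `u + t b` once
`‖u‖ < δ‖t‖` (`F(u + tb) = t^N F(b + u/t)`): the zeros of `t ↦ F(u + tb)` are bounded.
[cite: Garding1959, §2] -/
private theorem eval_add_smul_ne_zero {ι : Type*} [Fintype ι] {F : MvPolynomial ι ℂ} {N : ℕ}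
    (hF : F.IsHomogeneous N) {b : ι → ℂ} {δ : ℝ} (hδ : ∀ v, dist v b < δ → eval v F ≠ 0)
    {u : ι → ℂ} {t : ℂ} (ht : ‖u‖ < δ * ‖t‖) : eval (u + t • b) F ≠ 0 := by
  have ht0 : t ≠ 0 := by
    rintro rfl
    rw [norm_zero, mul_zero] at ht
    exact (norm_nonneg u).not_gt ht
  have htn : 0 < ‖t‖ := norm_pos_iff.2 ht0
  have hpt : u + t • b = t • (b + t⁻¹ • u) := by
    rw [smul_add, smul_smul, mul_inv_cancel₀ ht0, one_smul, add_comm]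
  rw [hpt, eval_smul_eq_pow_mul hF]
  refine mul_ne_zero (pow_ne_zero _ ht0) (hδ _ ?_)
  rw [dist_eq_norm, add_sub_cancel_left, norm_smul, norm_inv, ← div_eq_inv_mul, div_lt_iff₀ htn]
  exact ht

/-- Around a point where a polynomial is nonzero it stays nonzero. [folklore] -/
private theorem exists_ball_eval_ne_zero {ι : Type*} [Fintype ι] (F : MvPolynomial ι ℂ) {b : ι → ℂ}
    (hb : eval b F ≠ 0) : ∃ δ > 0, ∀ v, dist v b < δ → eval v F ≠ 0 := by
  have h := ((MvPolynomial.continuous_eval F).continuousAt (x := b)).eventually_ne hb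
  obtain ⟨δ, hδ, h⟩ := Metric.eventually_nhds_iff.1 h
  exact ⟨δ, hδ, fun v hv => h hv⟩

omit [Fintype σ] in
/-- `F > 0` on the open orthant (nonnegative coefficients, `f ≠ 0`), in particular `F(B) ≠ 0`.
[cite: BorceaBrandenLiggett2007, §4.1 proof of Thm. 4.5 ("`C_e(f_H)` contains the cone `ℝ_+^{n+1}`")] -/
private theorem eval_hom_orthant_ne_zero {f : MvPolynomial σ ℝ} (hf : IsRealStable f)
    (hnn : ∀ m, 0 ≤ coeff m f) {B : Option σ → ℝ} (hB : ∀ o, 0 < B o) :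
    eval (fun o => (B o : ℂ)) (map (algebraMap ℝ ℂ) (homogenize f.totalDegree f)) ≠ 0 := by
  rw [eval_map_real, Complex.ofReal_ne_zero]
  refine (eval_pos_of_coeff_nonneg (coeff_homogenize_nonneg hnn _) ?_ hB).ne'
  rw [Ne, homogenize_eq_zero_iff]
  exact hf.ne_zero'

/-- **Step 1 (Prop. 4.3: hyperbolicity of `f_H` in direction `e = (𝟙, 0)`).** `F(u + ie) ≠ 0` for every real
`u`: if `u₀ ≠ 0` this is `u₀^d f((u' + i𝟙)/u₀) ≠ 0` (stability of `f`, after conjugation when `u₀ < 0`),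
and if `u₀ = 0` it is `f_d(u' + i𝟙) ≠ 0` (stability of the top form). [cite: BorceaBrandenLiggett2007,
§4.1 Prop. 4.3] -/
private theorem eval_hom_real_add_ne_zero {f : MvPolynomial σ ℝ} (hf : IsRealStable f)
    (u : Option σ → ℝ) :
    eval (fun o => (u o : ℂ) + Option.elim o 0 fun _ => Complex.I)
      (map (algebraMap ℝ ℂ) (homogenize f.totalDegree f)) ≠ 0 := by
  by_cases hc : u none = 0
  · rw [eval_map_homogenize_of_eq_zero (algebraMap ℝ ℂ) le_rfl
      (by simp only [Option.elim_none, hc, Complex.ofReal_zero, add_zero])]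
    refine hf.homogeneousComponent_totalDegree _ fun i => ?_
    simp only [Option.elim_some, Complex.add_im, Complex.ofReal_im, Complex.I_im, zero_add, zero_lt_one]
  · have hc' : (fun o => (u o : ℂ) + Option.elim o 0 fun _ => Complex.I) none ≠ 0 := by
      simp only [Option.elim_none, add_zero, Ne, Complex.ofReal_eq_zero]
      exact hc
    rw [eval_map_homogenize_of_ne_zero (algebraMap ℝ ℂ) le_rfl hc']
    refine mul_ne_zero (pow_ne_zero _ hc') ?_
    simp only [Option.elim_none, Option.elim_some, add_zero]
    have him : ∀ i, (((u (some i) : ℂ) + Complex.I) / (u none : ℂ)).im = (u none)⁻¹ := by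
      intro i
      rw [Complex.div_ofReal_im, Complex.add_im, Complex.ofReal_im, Complex.I_im, zero_add, one_div]
    rcases lt_or_gt_of_ne hc with hneg | hpos
    · intro h0
      have h1 := congrArg conj h0
      rw [map_zero, eval_map, conj_eval₂_algebraMap, ← eval_map] at h1
      refine hf _ (fun i => ?_) h1
      rw [Pi.star_apply, Complex.star_def, Complex.conj_im, him, Left.neg_pos_iff, inv_lt_zero]
      exact hneg
    · exact hf _ fun i => by rw [him]; exact inv_pos.2 hpos

omit [Fintype σ] in
/-- **Step 2 (the base point `A = 0`).** `F(ie + tB) ≠ 0` for `Im t > 0`: by homogeneity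
`F(ie + tB) = t^d F(B + (i/t)e)`, and `F(B + λe) = B₀^d f(B'/B₀ + (λ/B₀)𝟙) = 0` forces `λ` real (line
criterion for `f`) and then `λ < 0` (`f > 0` on the open orthant), i.e. `Im t = Im (i/λ) < 0`.
[cite: BorceaBrandenLiggett2007, §4.1 proof of Thm. 4.5 ((3) ⇒ (4))] [cite: Garding1959, §2] -/
private theorem eval_hom_I_add_mul_ne_zero {f : MvPolynomial σ ℝ} (hf : IsRealStable f)
    (hnn : ∀ m, 0 ≤ coeff m f) {B : Option σ → ℝ} (hB : ∀ o, 0 < B o) {t : ℂ} (ht : 0 < t.im) :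
    eval (fun o => (Option.elim o 0 fun _ => Complex.I) + t * (B o : ℂ))
      (map (algebraMap ℝ ℂ) (homogenize f.totalDegree f)) ≠ 0 := by
  set F := map (algebraMap ℝ ℂ) (homogenize f.totalDegree f) with hF
  intro h0
  have ht0 : t ≠ 0 := by
    rintro rfl
    rw [Complex.zero_im] at ht
    exact lt_irrefl _ ht
  set c : ℝ := B none with hc
  have hc0 : 0 < c := hB none
  -- the rescaled point `v = B + (i/t) e`
  set v : Option σ → ℂ := fun o => (B o : ℂ) + Complex.I / t * Option.elim o 0 fun _ => (1 : ℂ) with hv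
  have hpt : (fun o => (Option.elim o 0 fun _ => Complex.I) + t * (B o : ℂ)) = t • v := by
    funext o
    rw [Pi.smul_apply, smul_eq_mul, hv]
    cases o with
    | none => simp only [Option.elim_none, zero_add, mul_zero, add_zero]
    | some i =>
      simp only [Option.elim_some, mul_one]
      rw [mul_add, mul_div_cancel₀ _ ht0, add_comm]
  rw [hpt, eval_smul_eq_pow_mul (isHomogeneous_map_homogenize le_rfl)] at h0
  have h1 : eval v F = 0 := (mul_eq_zero.1 h0).resolve_left (pow_ne_zero _ ht0)
  have hv0 : v none ≠ 0 := by
    simp only [hv, Option.elim_none, mul_zero, add_zero, Ne, Complex.ofReal_eq_zero]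
    exact hc0.ne'
  rw [hF, eval_map_homogenize_of_ne_zero (algebraMap ℝ ℂ) le_rfl hv0] at h1
  have h2 := (mul_eq_zero.1 h1).resolve_left (pow_ne_zero _ hv0)
  -- the point `v'/v₀` lies on the line `a + λ b` with `a = B'/c`, `b = 𝟙/c > 0`, `λ = i/t`
  have hline : (fun i => v (some i) / v none) =
      fun i => ((B (some i) / c : ℝ) : ℂ) + Complex.I / t * ((c⁻¹ : ℝ) : ℂ) := by
    funext i
    simp only [hv, Option.elim_some, Option.elim_none, mul_one, mul_zero, add_zero, Complex.ofReal_div,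
      Complex.ofReal_inv, hc]
    have hc' : (B none : ℂ) ≠ 0 := Complex.ofReal_ne_zero.2 (hB none).ne'
    field_simp
  rw [hline, eval_map] at h2
  have him : (Complex.I / t).im = 0 :=
    hf.im_eq_zero_of_eval₂_line_eq_zero (fun i => B (some i) / c) (fun _ => inv_pos.2 hc0) h2
  -- so `λ = i/t` is a real number `r`
  set r : ℝ := (Complex.I / t).re with hr
  have hlam : Complex.I / t = (r : ℂ) := Complex.ext (by rw [Complex.ofReal_re]) (by rw [him, Complex.ofReal_im])
  -- `r < 0`: otherwise the point lies in the open orthant, where `f > 0`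
  have hr0 : r < 0 := by
    by_contra hr0
    rw [not_lt] at hr0
    have hreal : (fun i => ((B (some i) / c : ℝ) : ℂ) + Complex.I / t * ((c⁻¹ : ℝ) : ℂ)) =
        fun i => ((B (some i) / c + r * c⁻¹ : ℝ) : ℂ) := by
      funext i
      rw [hlam]
      push_cast
      ring
    rw [hreal, ← eval_map, eval_map_real, Complex.ofReal_eq_zero] at h2
    have hpos := eval_pos_of_coeff_nonneg hnn hf.ne_zero' (x := fun i => B (some i) / c + r * c⁻¹)
      fun i => add_pos_of_pos_of_nonneg (div_pos (hB _) hc0) (mul_nonneg hr0 (inv_pos.2 hc0).le)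
    exact hpos.ne' h2
  -- hence `t = i/r` has negative imaginary part
  have hr' : (r : ℂ) ≠ 0 := Complex.ofReal_ne_zero.2 hr0.ne
  have h3 : Complex.I = (r : ℂ) * t := (div_eq_iff ht0).1 hlam
  have ht' : t = Complex.I / r := by
    rw [eq_div_iff hr', h3, mul_comm]
  have hti : t.im = r⁻¹ := by
    rw [ht', Complex.div_ofReal_im, Complex.I_im, one_div]
  rw [hti] at ht
  exact absurd (inv_pos.1 ht) (not_lt.2 hr0.le)

/-- **Step 3 (Gårding's root-continuity argument, Prop. 4.4 (d) for `f_H`).** For every real `A` and every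
`B` in the open orthant, `t ↦ F(A + ie + tB)` has no zero in the closed upper half-plane: along `s ↦ sA`,
`s ∈ [0, 1]`, no zero is real (Step 1), the zeros stay in a fixed disc (continuity of `F` at `B`), so the
set of `s` with a zero in the closed upper half-plane is closed; its least element is neither `0` (Step 2)
nor positive (Hurwitz: the earlier polynomials are upper-half-plane stable, so is their limit).
[cite: BorceaBrandenLiggett2007, §4.1 Prop. 4.4 (d) and proof of Thm. 4.5] [cite: Garding1959, §2]
[cite: Wagner2011, §2 (Hurwitz's theorem)] -/
private theorem eval_hom_line_ne_zero_of_im_nonneg {f : MvPolynomial σ ℝ} (hf : IsRealStable f)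
    (hnn : ∀ m, 0 ≤ coeff m f) (A : Option σ → ℝ) {B : Option σ → ℝ} (hB : ∀ o, 0 < B o)
    {t : ℂ} (ht : 0 ≤ t.im) :
    eval (fun o => (A o : ℂ) + (Option.elim o 0 fun _ => Complex.I) + t * (B o : ℂ))
      (map (algebraMap ℝ ℂ) (homogenize f.totalDegree f)) ≠ 0 := by
  classical
  set F := map (algebraMap ℝ ℂ) (homogenize f.totalDegree f) with hF
  -- the two-parameter evaluation `Φ s t = F(sA + ie + tB)` (kept opaque)
  obtain ⟨Φ, hΦ⟩ : ∃ Φ : ℝ → ℂ → ℂ, ∀ s t, Φ s t =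
      eval (fun o => ((s * A o : ℝ) : ℂ) + (Option.elim o 0 fun _ => Complex.I) + t * (B o : ℂ)) F :=
    ⟨_, fun _ _ => rfl⟩
  -- (a) joint continuity
  have hΦc : Continuous fun st : ℝ × ℂ => Φ st.1 st.2 := by
    simp only [hΦ]
    refine (MvPolynomial.continuous_eval F).comp (continuous_pi fun o => ?_)
    exact (((Complex.continuous_ofReal.comp (continuous_fst.mul continuous_const)).add
      continuous_const).add (continuous_snd.mul continuous_const))
  -- (b) no real zeros (Step 1)
  have hreal : ∀ (s : ℝ) (t : ℝ), Φ s t ≠ 0 := by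
    intro s t
    have hpt : (fun o => ((s * A o : ℝ) : ℂ) + (Option.elim o 0 fun _ => Complex.I) + (t : ℂ) * (B o : ℂ)) =
        fun o => ((s * A o + t * B o : ℝ) : ℂ) + Option.elim o 0 fun _ => Complex.I := by
      funext o
      push_cast
      ring
    rw [hΦ, hpt]
    exact eval_hom_real_add_ne_zero hf _
  -- (c) at `s = 0`, no zeros with `Im t > 0` (Step 2)
  have hzero : ∀ t : ℂ, 0 < t.im → Φ 0 t ≠ 0 := by
    intro t ht
    have hpt : (fun o => ((0 * A o : ℝ) : ℂ) + (Option.elim o 0 fun _ => Complex.I) + t * (B o : ℂ)) =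
        fun o => (Option.elim o 0 fun _ => Complex.I) + t * (B o : ℂ) := by
      funext o
      rw [zero_mul, Complex.ofReal_zero, zero_add]
    rw [hΦ, hpt]
    exact eval_hom_I_add_mul_ne_zero hf hnn hB ht
  -- (d) the zeros are bounded, uniformly in `s ∈ [0, 1]`
  obtain ⟨δ, hδ, hball⟩ := exists_ball_eval_ne_zero F (eval_hom_orthant_ne_zero hf hnn hB)
  obtain ⟨R, hroot⟩ : ∃ R : ℝ, ∀ s ∈ Set.Icc (0 : ℝ) 1, ∀ t : ℂ, Φ s t = 0 → ‖t‖ ≤ R := by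
    set M : ℝ := ‖fun o => (A o : ℂ)‖ + ‖fun o : Option σ => (Option.elim o 0 fun _ => Complex.I)‖ with hM
    refine ⟨M / δ, fun s hs t h0 => ?_⟩
    by_contra hlt
    rw [not_le] at hlt
    have hsA : ‖fun o => ((s * A o : ℝ) : ℂ)‖ ≤ ‖fun o => (A o : ℂ)‖ := by
      have : (fun o => ((s * A o : ℝ) : ℂ)) = (s : ℂ) • fun o => (A o : ℂ) := by
        funext o
        simp only [Complex.ofReal_mul, Pi.smul_apply, smul_eq_mul]
      rw [this, norm_smul, Complex.norm_real, Real.norm_eq_abs, abs_of_nonneg hs.1]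
      exact mul_le_of_le_one_left (norm_nonneg _) hs.2
    have hu : ‖(fun o => ((s * A o : ℝ) : ℂ)) + fun o => (Option.elim o 0 fun _ => Complex.I)‖ <
        δ * ‖t‖ :=
      calc _ ≤ ‖fun o => ((s * A o : ℝ) : ℂ)‖ +
            ‖fun o : Option σ => (Option.elim o 0 fun _ => Complex.I)‖ := norm_add_le _ _
        _ ≤ M := by rw [hM]; gcongr
        _ = δ * (M / δ) := by rw [mul_div_cancel₀ _ hδ.ne']
        _ < δ * ‖t‖ := mul_lt_mul_of_pos_left hlt hδ
    refine eval_add_smul_ne_zero (isHomogeneous_map_homogenize le_rfl) hball hu (b := fun o => (B o : ℂ)) ?_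
    have hpt : ((fun o => ((s * A o : ℝ) : ℂ)) + fun o => (Option.elim o 0 fun _ => Complex.I)) +
        t • (fun o => (B o : ℂ)) =
        fun o => ((s * A o : ℝ) : ℂ) + (Option.elim o 0 fun _ => Complex.I) + t * (B o : ℂ) := by
      funext o
      simp only [Pi.add_apply, Pi.smul_apply, smul_eq_mul]
    rw [hpt, ← hΦ]
    exact h0
  -- (e) the set of bad parameters is closed
  have hKc : IsCompact {t : ℂ | 0 ≤ t.im ∧ ‖t‖ ≤ R} := by
    have : {t : ℂ | 0 ≤ t.im ∧ ‖t‖ ≤ R} = Metric.closedBall 0 R ∩ {t : ℂ | 0 ≤ t.im} := by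
      ext t
      simp only [Set.mem_setOf_eq, Set.mem_inter_iff, Metric.mem_closedBall, dist_zero_right, and_comm]
    rw [this]
    exact (isCompact_closedBall _ _).inter_right (isClosed_le continuous_const Complex.continuous_im)
  obtain ⟨Bad, hBad⟩ : ∃ Bad : Set ℝ, ∀ s, s ∈ Bad ↔ s ∈ Set.Icc (0 : ℝ) 1 ∧ ∃ t : ℂ, 0 ≤ t.im ∧ Φ s t = 0 :=
    ⟨{s | s ∈ Set.Icc (0 : ℝ) 1 ∧ ∃ t : ℂ, 0 ≤ t.im ∧ Φ s t = 0}, fun _ => Iff.rfl⟩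
  have hBadc : IsClosed Bad := by
    haveI : CompactSpace {t : ℂ | 0 ≤ t.im ∧ ‖t‖ ≤ R} := isCompact_iff_compactSpace.1 hKc
    have hZc : IsClosed {p : ℝ × {t : ℂ | 0 ≤ t.im ∧ ‖t‖ ≤ R} |
        p.1 ∈ Set.Icc (0 : ℝ) 1 ∧ Φ p.1 (p.2 : ℂ) = 0} := by
      refine (isClosed_Icc.preimage continuous_fst).inter ?_
      exact isClosed_eq (hΦc.comp (continuous_fst.prodMk (continuous_subtype_val.comp continuous_snd)))
        continuous_const
    have himg : Bad = Prod.fst '' {p : ℝ × {t : ℂ | 0 ≤ t.im ∧ ‖t‖ ≤ R} |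
        p.1 ∈ Set.Icc (0 : ℝ) 1 ∧ Φ p.1 (p.2 : ℂ) = 0} := by
      ext s
      rw [hBad]
      constructor
      · rintro ⟨hs, t, ht, h0⟩
        exact ⟨(s, ⟨t, ht, hroot s hs t h0⟩), ⟨hs, h0⟩, rfl⟩
      · rintro ⟨⟨s', t⟩, ⟨hs', h0⟩, rfl⟩
        exact ⟨hs', t.1, t.2.1, h0⟩
    rw [himg]
    exact isClosedMap_fst_of_compactSpace _ hZc
  -- (f) conclusion: the least bad parameter cannot exist
  intro h0
  have h1 : (1 : ℝ) ∈ Bad := by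
    rw [hBad]
    refine ⟨⟨zero_le_one, le_rfl⟩, t, ht, ?_⟩
    rw [hΦ]
    simp only [one_mul]
    exact h0
  have hne : Bad.Nonempty := ⟨1, h1⟩
  have hbdd : BddBelow Bad := ⟨0, fun s hs => ((hBad s).1 hs).1.1⟩
  obtain ⟨⟨hs₀0, hs₀1⟩, t₀, ht₀, hΦ₀⟩ := (hBad _).1 (hBadc.csInf_mem hne hbdd)
  have ht₀' : 0 < t₀.im := by
    refine lt_of_le_of_ne ht₀ fun him => ?_
    have : t₀ = ((t₀.re : ℝ) : ℂ) :=
      Complex.ext (by rw [Complex.ofReal_re]) (by rw [Complex.ofReal_im, ← him])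
    rw [this] at hΦ₀
    exact hreal _ _ hΦ₀
  rcases hs₀0.eq_or_lt with h00 | hpos
  · rw [← h00] at hΦ₀
    exact hzero t₀ ht₀' hΦ₀
  · -- Hurwitz along `s ↑ sInf Bad`: the univariate family `s ↦ (t ↦ Φ s t)`
    let P : ℝ → MvPolynomial Unit ℂ := fun s =>
      bind₁ (fun o => C (((s * A o : ℝ) : ℂ) + Option.elim o 0 fun _ => Complex.I) + X () * C ((B o : ℝ) : ℂ))
        F
    have hPeval : ∀ s z, eval z (P s) = Φ s (z ()) := by
      intro s z
      rw [hΦ]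
      simp only [P, eval_bind₁, map_add, map_mul, eval_C, eval_X]
    have hPc : Continuous fun sz : ℝ × (Unit → ℂ) => eval sz.2 (P sz.1) := by
      simp only [hPeval]
      exact hΦc.comp (continuous_fst.prodMk ((continuous_apply ()).comp continuous_snd))
    have hPs : ∀ s ∈ Set.Ico (0 : ℝ) (sInf Bad), IsUpperHalfPlaneStable (P s) := by
      intro s hs z hz h0'
      rw [hPeval] at h0'
      have hsBad : s ∈ Bad := by
        rw [hBad]
        exact ⟨⟨hs.1, hs.2.le.trans hs₀1⟩, z (), (hz ()).le, h0'⟩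
      exact absurd (csInf_le hbdd hsBad) (not_le.2 hs.2)
    have hcl : sInf Bad ∈ closure (Set.Ico (0 : ℝ) (sInf Bad)) := by
      rw [closure_Ico hpos.ne]
      exact ⟨hs₀0, le_rfl⟩
    rcases eq_zero_or_isUpperHalfPlaneStable_of_mem_closure hPc hPs hcl with hz | hst
    · have h' := hPeval (sInf Bad) fun _ => (0 : ℂ)
      rw [hz, map_zero] at h'
      have h'' := hreal (sInf Bad) 0
      rw [Complex.ofReal_zero] at h''
      exact h'' h'.symm
    · exact hst (fun _ => t₀) (fun _ => ht₀') (by rw [hPeval]; exact hΦ₀)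

/-- **Step 4 (`α → 0⁺`).** `t ↦ F(A + tB)` has no zero with `Im t > 0`: the polynomials
`t ↦ F(A + iαe + tB) = α^d F(A/α + ie + (t/α)B)`, `α > 0`, are upper half-plane stable by Step 3, and so is
their limit at `α = 0` (Hurwitz; it is not the zero polynomial since `F(A + tB) ≠ 0` for large real `t`).
[cite: BorceaBrandenLiggett2007, §4.1 proof of Thm. 4.5 ((4) ⇒ (1))] [cite: Garding1959, §2] -/
private theorem eval_hom_line_ne_zero_of_im_pos {f : MvPolynomial σ ℝ} (hf : IsRealStable f)
    (hnn : ∀ m, 0 ≤ coeff m f) (A : Option σ → ℝ) {B : Option σ → ℝ} (hB : ∀ o, 0 < B o)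
    {t : ℂ} (ht : 0 < t.im) :
    eval (fun o => (A o : ℂ) + t * (B o : ℂ)) (map (algebraMap ℝ ℂ) (homogenize f.totalDegree f)) ≠ 0 := by
  classical
  set d := f.totalDegree with hd
  set F := map (algebraMap ℝ ℂ) (homogenize d f) with hF
  -- the univariate family `α ↦ (t ↦ F(A + iαe + tB))`
  let P : ℝ → MvPolynomial Unit ℂ := fun α =>
    bind₁ (fun o => C ((A o : ℂ) + (α : ℂ) * Option.elim o 0 fun _ => Complex.I) + X () * C ((B o : ℝ) : ℂ)) F
  have hPeval : ∀ α z, eval z (P α) =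
      eval (fun o => (A o : ℂ) + (α : ℂ) * (Option.elim o 0 fun _ => Complex.I) + z () * (B o : ℂ)) F := by
    intro α z
    simp only [P, eval_bind₁, map_add, map_mul, eval_C, eval_X]
  have hPc : Continuous fun az : ℝ × (Unit → ℂ) => eval az.2 (P az.1) := by
    simp only [hPeval]
    refine (MvPolynomial.continuous_eval F).comp (continuous_pi fun o => ?_)
    exact (continuous_const.add ((Complex.continuous_ofReal.comp continuous_fst).mul continuous_const)).add
      (((continuous_apply ()).comp continuous_snd).mul continuous_const)
  have hPs : ∀ α ∈ Set.Ioi (0 : ℝ), IsUpperHalfPlaneStable (P α) := by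
    intro α hα z hz
    rw [hPeval]
    have hα0 : (α : ℂ) ≠ 0 := Complex.ofReal_ne_zero.2 (ne_of_gt hα)
    have hpt : (fun o => (A o : ℂ) + (α : ℂ) * (Option.elim o 0 fun _ => Complex.I) + z () * (B o : ℂ)) =
        (α : ℂ) • fun o => ((A o / α : ℝ) : ℂ) + (Option.elim o 0 fun _ => Complex.I) + z () / α * (B o : ℂ) := by
      funext o
      simp only [Pi.smul_apply, smul_eq_mul, Complex.ofReal_div]
      field_simp
    rw [hpt, eval_smul_eq_pow_mul (isHomogeneous_map_homogenize le_rfl)]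
    refine mul_ne_zero (pow_ne_zero _ hα0) ?_
    exact eval_hom_line_ne_zero_of_im_nonneg hf hnn (fun o => A o / α) hB
      (by rw [Complex.div_ofReal_im]; exact (div_pos (hz ()) hα).le)
  have hcl : (0 : ℝ) ∈ closure (Set.Ioi (0 : ℝ)) := by
    rw [closure_Ioi]
    exact Set.self_mem_Ici
  rcases eq_zero_or_isUpperHalfPlaneStable_of_mem_closure hPc hPs hcl with hz | hst
  · -- `P 0 = 0` would make `F(A + tB) = 0` for all `t`, absurd for large real `t`
    exfalso
    obtain ⟨δ, hδ, hball⟩ := exists_ball_eval_ne_zero F (eval_hom_orthant_ne_zero hf hnn hB)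
    set T : ℝ := ‖fun o => (A o : ℂ)‖ / δ + 1 with hT
    have hT0 : 0 < T := by positivity
    have hu : ‖fun o => (A o : ℂ)‖ < δ * ‖(T : ℂ)‖ := by
      rw [Complex.norm_real, Real.norm_eq_abs, abs_of_pos hT0, hT, mul_add, mul_div_cancel₀ _ hδ.ne', mul_one]
      exact lt_add_of_pos_right _ hδ
    refine eval_add_smul_ne_zero (isHomogeneous_map_homogenize le_rfl) hball hu (b := fun o => (B o : ℂ)) ?_
    have h' := hPeval 0 fun _ => (T : ℂ)
    rw [hz, map_zero] at h'
    have hpt : ((fun o => (A o : ℂ)) + (T : ℂ) • fun o => (B o : ℂ)) =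
        fun o => (A o : ℂ) + ((0 : ℝ) : ℂ) * (Option.elim o 0 fun _ => Complex.I) + (T : ℂ) * (B o : ℂ) := by
      funext o
      simp only [Pi.add_apply, Pi.smul_apply, smul_eq_mul, Complex.ofReal_zero, zero_mul, add_zero]
    rw [hpt]
    exact h'.symm
  · have h' := hst (fun _ => t) (fun _ => ht)
    rw [hPeval] at h'
    simpa only [Complex.ofReal_zero, zero_mul, add_zero] using h'

end Garding

/-! ## §4 Theorem 4.5 (1) ⇔ (2) -/

section Main

variable {σ : Type*} [Fintype σ]

/-- `zᵢ^k` is stable. [folklore] -/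
private theorem isUpperHalfPlaneStable_X_pow {τ : Type*} (i : τ) (k : ℕ) :
    IsUpperHalfPlaneStable ((X i : MvPolynomial τ ℂ) ^ k) := by
  induction k with
  | zero =>
    rw [pow_zero, ← C_1]
    exact isUpperHalfPlaneStable_C one_ne_zero
  | succ k ih =>
    rw [pow_succ]
    exact ih.mul (isUpperHalfPlaneStable_X i)

/-- **Borcea–Brändén–Liggett, Theorem 4.5, (2) ⇒ (1), for `f_H` itself** (`N = deg f`): a real stable
polynomial with nonnegative coefficients has a real stable homogenization. The printed chain
(2) ⇒ (3) (Prop. 4.3) ⇒ (4) (Prop. 4.4 (b), (d)) ⇒ (1) (line criterion) is §3 plus `isRealStable_of_line`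
and conjugation symmetry. [cite: BorceaBrandenLiggett2007, §4.1 Thm. 4.5] -/
theorem IsRealStable.homogenize_totalDegree {f : MvPolynomial σ ℝ} (hf : IsRealStable f)
    (hnn : ∀ m, 0 ≤ coeff m f) : IsRealStable (homogenize f.totalDegree f) := by
  refine isRealStable_of_line fun A B hB t h0 => ?_
  by_contra him
  rcases lt_or_gt_of_ne him with hlt | hgt
  · -- a zero with `Im t < 0` conjugates to one with `Im t > 0`
    have h1 := congrArg conj h0
    rw [map_zero, conj_eval₂_algebraMap] at h1
    have hstar : star (fun o => (A o : ℂ) + t * (B o : ℂ)) = fun o => (A o : ℂ) + conj t * (B o : ℂ) := by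
      funext o
      simp only [Pi.star_apply, Complex.star_def, map_add, Complex.conj_ofReal, map_mul]
    rw [hstar, ← eval_map] at h1
    exact eval_hom_line_ne_zero_of_im_pos hf hnn A hB (by rw [Complex.conj_im]; linarith) h1
  · rw [← eval_map] at h0
    exact eval_hom_line_ne_zero_of_im_pos hf hnn A hB hgt h0

/-- **Borcea–Brändén–Liggett, Theorem 4.5, (2) ⇒ (1)**: "Suppose that all the coefficients of
`f ∈ ℝ[z_1, …, z_n]` are non-negative. [If] `f` is stable [then] `f_H` is stable" — for `homogenize N f`,
any `N ≥ deg f` (`= z₀^{N - deg f} f_H`). [cite: BorceaBrandenLiggett2007, §4.1 Thm. 4.5] -/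
theorem IsRealStable.homogenize {f : MvPolynomial σ ℝ} (hf : IsRealStable f) (hnn : ∀ m, 0 ≤ coeff m f)
    {N : ℕ} (hN : f.totalDegree ≤ N) : IsRealStable (homogenize N f) := by
  obtain ⟨k, rfl⟩ := Nat.exists_eq_add_of_le hN
  have h := hf.homogenize_totalDegree hnn
  rw [IsRealStable] at h ⊢
  rw [homogenize_add_eq_X_pow_mul le_rfl, map_mul, map_pow, map_X]
  exact (isUpperHalfPlaneStable_X_pow none k).mul h

/-- **Borcea–Brändén–Liggett, Theorem 4.5, (1) ⇒ (2)**: if `f_H` (here `homogenize N f`, `N ≥ deg f`) is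
stable then `f` is stable — for every real `f` (the printed proof sets `z₀ := 1`; here `f(z) = 0` with
`z ∈ H^n` gives the zero `(λz, λ)` of the form `f_H`, `λ = 1 + iε`, which lies in `H^{n+1}` for small
`ε > 0`). [cite: BorceaBrandenLiggett2007, §4.1 Thm. 4.5 ((1) ⇒ (2))] -/
theorem isRealStable_of_isRealStable_homogenize {f : MvPolynomial σ ℝ} {N : ℕ} (hN : f.totalDegree ≤ N)
    (h : IsRealStable (homogenize N f)) : IsRealStable f := by
  rw [IsRealStable, isUpperHalfPlaneStable_iff]
  intro z hz h0
  -- `ε` with `Im ((1 + iε) z_j) > 0` for all `j`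
  set S : ℝ := ∑ j, |(z j).re| / (z j).im with hS
  have hS0 : 0 ≤ S := Finset.sum_nonneg fun j _ => div_nonneg (abs_nonneg _) (hz j).le
  set ε : ℝ := (1 + S)⁻¹ with hε
  have hε0 : 0 < ε := by positivity
  set l : ℂ := 1 + (ε : ℂ) * Complex.I with hl
  have hlim : l.im = ε := by simp [hl]
  have hlre : l.re = 1 := by simp [hl]
  have hl0 : l ≠ 0 := fun h => by
    have := congrArg Complex.re h
    rw [hlre, Complex.zero_re] at this
    exact one_ne_zero this
  have hlz : ∀ j, 0 < (l * z j).im := by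
    intro j
    have h1 : (l * z j).im = (z j).im + ε * (z j).re := by
      rw [Complex.mul_im, hlre, hlim, one_mul, add_comm]
    rw [h1]
    have h3 : |(z j).re| / (z j).im ≤ S :=
      Finset.single_le_sum (f := fun i => |(z i).re| / (z i).im)
        (fun i _ => div_nonneg (abs_nonneg _) (hz i).le) (Finset.mem_univ j)
    have h4 : |(z j).re| ≤ S * (z j).im := (div_le_iff₀ (hz j)).1 h3
    have h2 : ε * |(z j).re| < (z j).im := by
      rw [hε, inv_mul_lt_iff₀ (by positivity : (0 : ℝ) < 1 + S)]
      nlinarith [hz j]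
    have h5 : -(ε * |(z j).re|) ≤ ε * (z j).re := by
      rw [← mul_neg]
      exact mul_le_mul_of_nonneg_left (neg_abs_le _) hε0.le
    linarith
  -- the point `(λz, λ) ∈ H^{n+1}` is a zero of the form `f_H`
  have hw := h (fun o => Option.elim o l fun j => l * z j) fun o => by
    cases o with
    | none => simpa only [Option.elim_none, hlim] using hε0
    | some j => simpa only [Option.elim_some] using hlz j
  apply hw
  rw [eval_map_homogenize_of_ne_zero (algebraMap ℝ ℂ) hN (by simpa only [Option.elim_none] using hl0)]
  simp only [Option.elim_none, Option.elim_some]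
  have : (fun i => l * z i / l) = z := funext fun i => by field_simp
  rw [this, h0, mul_zero]

/-- **Borcea–Brändén–Liggett, Theorem 4.5, (1) ⇔ (2)**: for `f ∈ ℝ[z_1, …, z_n]` with non-negative
coefficients (and `N ≥ deg f`), `homogenize N f` is real stable iff `f` is real stable.
[cite: BorceaBrandenLiggett2007, §4.1 Thm. 4.5] -/
theorem isRealStable_homogenize_iff {f : MvPolynomial σ ℝ} (hnn : ∀ m, 0 ≤ coeff m f) {N : ℕ}
    (hN : f.totalDegree ≤ N) : IsRealStable (homogenize N f) ↔ IsRealStable f :=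
  ⟨isRealStable_of_isRealStable_homogenize hN, fun hf => hf.homogenize hnn hN⟩

end Main

/-! ## §5 Linearity of `homogenize N` -/

section Linear

variable {σ : Type*} {R : Type*} [CommSemiring R]

/-- **`homogenize N` is additive.** [cite: BorceaBrandenLiggett2007, §4.1 (definition of `f_H`)] -/
theorem homogenize_add (N : ℕ) (f g : MvPolynomial σ R) :
    homogenize N (f + g) = homogenize N f + homogenize N g := by
  ext n
  rw [coeff_add, coeff_homogenize, coeff_homogenize, coeff_homogenize, coeff_add]
  split_ifs
  · rfl
  · rw [add_zero]

/-- **`homogenize N` commutes with scalars.** [cite: BorceaBrandenLiggett2007, §4.1 (definition of `f_H`)] -/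
theorem homogenize_smul (N : ℕ) (c : R) (f : MvPolynomial σ R) :
    homogenize N (c • f) = c • homogenize N f := by
  ext n
  rw [coeff_smul, coeff_homogenize, coeff_homogenize, coeff_smul]
  split_ifs
  · rfl
  · rw [smul_zero]

/-- `homogenize N 0 = 0`. [cite: BorceaBrandenLiggett2007, §4.1] -/
theorem homogenize_zero (N : ℕ) : homogenize N (0 : MvPolynomial σ R) = 0 :=
  (homogenize_eq_zero_iff N 0).2 rfl

/-- **`homogenize N` of a monomial**: `z^α ↦ z^α z₀^{N-|α|}`. [cite: BorceaBrandenLiggett2007, §4.1 (definition of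
`f_H`)] -/
theorem homogenize_monomial (N : ℕ) (m : σ →₀ ℕ) (a : R) :
    homogenize N (monomial m a) = monomial (m.optionElim (N - m.degree)) a := by
  classical
  ext n
  rw [coeff_homogenize, coeff_monomial, coeff_monomial]
  by_cases hn : n none = N - n.some.degree
  · rw [if_pos hn]
    by_cases hm : m = n.some
    · subst hm
      rw [if_pos rfl, if_pos]
      rw [← hn]
      exact Finsupp.optionElim_some n
    · rw [if_neg hm, if_neg]
      intro h
      apply hm
      rw [← h, Finsupp.some_optionElim]
  · rw [if_neg hn, if_neg]
    intro h
    apply hn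
    rw [← h, Finsupp.optionElim_apply_none, Finsupp.some_optionElim]

/-- `homogenize N (C a) = a z₀^N`. [cite: BorceaBrandenLiggett2007, §4.1] -/
theorem homogenize_C (N : ℕ) (a : R) : homogenize N (C a : MvPolynomial σ R) = monomial (Finsupp.single none N) a := by
  rw [← monomial_zero', homogenize_monomial, Finsupp.optionElim_zero, map_zero, Nat.sub_zero]

/-- `homogenize N (z_i) = z_i z₀^{N-1}` (for `N = 0` both sides are `z_i`, truncated subtraction).
[cite: BorceaBrandenLiggett2007, §4.1] -/
theorem homogenize_X (N : ℕ) (i : σ) :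
    homogenize N (X i : MvPolynomial σ R) = X (some i) * X none ^ (N - 1) := by
  classical
  have hexp : (Finsupp.single i 1 : σ →₀ ℕ).optionElim (N - 1) =
      Finsupp.single (some i) 1 + Finsupp.single none (N - 1) := by
    refine Finsupp.ext fun o => ?_
    cases o with
    | none => simp
    | some j =>
      rw [Finsupp.optionElim_apply_some, Finsupp.add_apply, Finsupp.single_apply, Finsupp.single_apply,
        Finsupp.single_apply]
      simp only [Option.some.injEq, reduceCtorEq, if_false, add_zero]
  rw [X, homogenize_monomial, Finsupp.degree_single, hexp, X, X_pow_eq_monomial, monomial_mul, one_mul]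

/-- **`homogenize N` of a finite sum.** [cite: BorceaBrandenLiggett2007, §4.1] -/
theorem homogenize_sum {ι : Type*} (N : ℕ) (s : Finset ι) (f : ι → MvPolynomial σ R) :
    homogenize N (∑ i ∈ s, f i) = ∑ i ∈ s, homogenize N (f i) := by
  classical
  induction s using Finset.induction_on with
  | empty => rw [Finset.sum_empty, Finset.sum_empty, homogenize_zero]
  | insert a s ha ih => rw [Finset.sum_insert ha, Finset.sum_insert ha, homogenize_add, ih]

/-- **`f_H` as a sum over the support of `f`, recovered from linearity** (consistency of the two descriptions).
[cite: BorceaBrandenLiggett2007, §4.1] -/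
theorem homogenize_eq_sum_monomial (N : ℕ) (f : MvPolynomial σ R) :
    homogenize N f = ∑ m ∈ f.support, homogenize N (monomial m (coeff m f)) := by
  conv_lhs => rw [← support_sum_monomial_coeff f]
  rw [homogenize_sum]

end Linear

end Literature.Combinatorics.StablePolynomials

end
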